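import Summits.AtomisticToContinuum.FouriersLaw.Theorems.IncoherentChannel.Negative.LoadBearing
import Summits.AtomisticToContinuum.FouriersLaw.Theorems.IncoherentChannel.Negative.UnitTemperature
import Literature.Barriers.AtomisticToContinuum.FixedLengthNoConductivityControl

/-!
# `PhononMeanFreePath.IncoherentBounded` — its exact logical position in the route (support lemmas)

Item `stmt-AtomisticToContinuum-11815` (support, route `PhononMeanFreePath`, sub-problem `FouriersLaw`):
`IncoherentBounded` — for `pinnedChain ω₂ lam β γ` (all parameters `> 0`) and `T > 0`,
`sup_N |a_N| < ∞` with `a_N = N (γ²/T²) ∫_{t>0} [C_N(t) - 2 r_N(t)²] dt`, where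
`r_N(t) = ∫ p₀ · (K_t p_N) dμ₀` and `C_N(t) = ∫ p₀² (K_t p_N²) dμ₀ - (∫ p₀² dμ₀)(∫ K_t p_N² dμ₀)`
(`μ₀ = gibbsMeasure (N+1) T`, `K_t = transitionKernel (N+1) T T t`, both constructed in Literature).

This file records, sorry-free and without new definitions, where the item sits logically:

* `incoherentBounded_of_incoherentChannel` — the crux `IncoherentChannel` (`a_N → κ(T) > 0`) implies it
  outright (convergent real sequences are bounded): the item is the finiteness half of the crux.
* `incoherentBounded_iff_boundedResponse` — under the route's other items `NessUnique`, `BoundaryKubo`,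
  `CoherentDephasing` the item is EQUIVALENT to the route item `BoundedResponse`
  (stmt-AtomisticToContinuum-11071), i.e. (`incoherentBounded_iff_hasBoundedResponse`) to the catalogued
  necessary waypoint `Literature.Barriers.AtomisticToContinuum.HasBoundedResponse (pinnedChain ω₂ lam β γ)`
  for all parameters `> 0` ("`κ_N` bounded uniformly in `N`", barrier file
  `FixedLengthNoConductivityControl`: a documented absence of any `N`-uniform bound for deterministic
  anharmonic chains). The forward direction is the route's glue item `ChannelsBoundedResponse`; the
  converse shows the item is not easier than the waypoint once the sibling cruxes stand.
* `incoherentBounded_of_fouriersLaw` — under the same three items the sub-problem conjunct `FouriersLaw`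
  implies the item (via `incoherentChannel_iff_fouriersLaw` of `IncoherentChannel.Negative.LoadBearing`).
* `incoherentBounded_iff_unit_temperature` — by the exact amplitude-scaling invariance of the sequence
  (`a_N(lam, β, s²T) = a_N(lam s², β s², T)`, `IncoherentChannel.Negative.UnitTemperature.seqA_smul`) the item is
  equivalent to its `T = 1` slice: temperature enters only through the effective couplings `lam·T`, `β·T`.
-/

noncomputable section

open MeasureTheory Filter Topology Set
open Literature.MathematicalPhysics.KineticTheory.HeatConduction
open Literature.Barriers.AtomisticToContinuum
open Summit.AtomisticToContinuum.FouriersLaw.Theses.PhononMeanFreePath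

namespace Summit.AtomisticToContinuum.FouriersLaw.Theorems.IncoherentBounded

/-! ## 1. The crux implies the item -/

/-- A convergent real sequence is bounded in absolute value by one constant. [folklore] -/
theorem exists_forall_abs_le_of_tendsto {a : ℕ → ℝ} {κ : ℝ} (h : Tendsto a atTop (𝓝 κ)) :
    ∃ B : ℝ, ∀ N, |a N| ≤ B := by
  obtain ⟨B, hB⟩ := ((continuous_abs.tendsto _).comp h).bddAbove_range
  exact ⟨B, fun N => hB ⟨N, rfl⟩⟩

/-- **`IncoherentChannel → IncoherentBounded`**: the item is the finiteness half of the crux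
(`a_N → κ(T)` forces `sup_N |a_N| < ∞`). [folklore] -/
theorem incoherentBounded_of_incoherentChannel (h : IncoherentChannel) : IncoherentBounded := by
  intro ω₂ lam β γ hω hl hβ hγ T hT
  obtain ⟨κ, -, hκ⟩ := h ω₂ lam β γ hω hl hβ hγ T hT
  exact exists_forall_abs_le_of_tendsto hκ

/-! ## 2. Under the sibling items the item is the bounded-response waypoint -/

/-- Splitting the Kubo integral into the two channels: `∫ C = ∫ (C - 2r²) + 2 ∫ r²` when both
`C` and `r²` are integrable on `(0, ∞)`. [folklore] -/
theorem integral_split {C r : ℝ → ℝ} (hC : IntegrableOn C (Set.Ioi 0))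
    (hr : IntegrableOn (fun t => r t ^ 2) (Set.Ioi 0)) :
    ∫ t in Set.Ioi (0:ℝ), C t =
      (∫ t in Set.Ioi (0:ℝ), (C t - 2 * r t ^ 2)) + 2 * ∫ t in Set.Ioi (0:ℝ), r t ^ 2 := by
  have h2 : IntegrableOn (fun t => 2 * r t ^ 2) (Set.Ioi 0) := hr.const_mul 2
  rw [integral_sub hC h2, integral_const_mul]
  ring

/-- **Under `NessUnique`, `BoundaryKubo`, `CoherentDephasing`: `IncoherentBounded ↔ BoundedResponse`.**
(→) is the route's glue `ChannelsBoundedResponse`: along any steady-state family the response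
coefficients are identified with `D₀ = 0`, `D_{N+1} = N(γ²/T²)∫C_N` (uniqueness of limits on `𝓝[≠] 0`),
and `N(γ²/T²)∫C_N = a_N + 2(γ²/T²)·N∫r_N²` with both summands bounded. (←): along the canonical
steady-state family (`pinnedChain_exists_isSteadyState`) `BoundedResponse` bounds `|D_{N+1}|`, and
`a_N = D_{N+1} - 2(γ²/T²)·N∫r_N²` with `N∫r_N² → 0` bounded.
[cite: BonettoLebowitzReyBellet2000, §6.3 (arXiv p. 12)] -/
theorem incoherentBounded_iff_boundedResponse (hU : NessUnique) (hK : BoundaryKubo)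
    (hA : CoherentDephasing) : IncoherentBounded ↔ BoundedResponse := by
  constructor
  · -- (→): ChannelsBoundedResponse
    intro hB ω₂ lam β γ hω hl hβ hγ μ hμ T hT D hD
    have hKT := hK ω₂ lam β γ hω hl hβ hγ (hU ω₂ lam β γ hω hl hβ hγ) μ hμ T hT
    have hAT := hA ω₂ lam β γ hω hl hβ hγ T hT
    obtain ⟨B, hBN⟩ := hB ω₂ lam β γ hω hl hβ hγ T hT
    obtain ⟨B₂, hB₂⟩ := exists_forall_abs_le_of_tendsto hAT.2
    -- the two channel functions
    set Cf : ℕ → ℝ → ℝ := fun N t => ((∫ z, (z.2 0) ^ 2 * (∫ y, (y.2 (Fin.last N)) ^ 2 ∂((pinnedChain ω₂ lam β γ).transitionKernel (N + 1) T T t.toNNReal z)) ∂((pinnedChain ω₂ lam β γ).gibbsMeasure (N + 1) T)) - (∫ z, (z.2 0) ^ 2 ∂((pinnedChain ω₂ lam β γ).gibbsMeasure (N + 1) T)) * (∫ z, (∫ y, (y.2 (Fin.last N)) ^ 2 ∂((pinnedChain ω₂ lam β γ).transitionKernel (N + 1) T T t.toNNReal z)) ∂((pinnedChain ω₂ lam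 β γ).gibbsMeasure (N + 1) T))) with hCf
    set rf : ℕ → ℝ → ℝ := fun N t => (∫ z, z.2 0 * (∫ y, y.2 (Fin.last N) ∂((pinnedChain ω₂ lam β γ).transitionKernel (N + 1) T T t.toNNReal z)) ∂((pinnedChain ω₂ lam β γ).gibbsMeasure (N + 1) T)) with hrf
    have hDK : ∀ N : ℕ, D (N + 1) = (N : ℝ) * (γ ^ 2 / T ^ 2) * ∫ t in Set.Ioi (0 : ℝ), Cf N t :=
      fun N => tendsto_nhds_unique (hD (N + 1)) (hKT N).2
    have hD0 : D 0 = 0 := by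
      have h0 := hD 0
      simp only [OscillatorChain.totalCurrent_zero, zero_div] at h0
      exact tendsto_nhds_unique h0 tendsto_const_nhds
    have hsplit : ∀ N : ℕ, (N : ℝ) * (γ ^ 2 / T ^ 2) * (∫ t in Set.Ioi (0 : ℝ), Cf N t) =
        (N : ℝ) * (γ ^ 2 / T ^ 2) * (∫ t in Set.Ioi (0 : ℝ), (Cf N t - 2 * rf N t ^ 2)) +
          2 * (γ ^ 2 / T ^ 2) * ((N : ℝ) * ∫ t in Set.Ioi (0 : ℝ), rf N t ^ 2) := by
      intro N
      rw [integral_split (hKT N).1 (hAT.1 N)]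
      ring
    refine ⟨max 0 (B + 2 * (γ ^ 2 / T ^ 2) * B₂), ?_⟩
    rintro _ ⟨M, rfl⟩
    cases M with
    | zero => simp [hD0]
    | succ N =>
      refine le_max_of_le_right ?_
      have h1 := hBN N
      have h2 := hB₂ N
      have hg : 0 ≤ 2 * (γ ^ 2 / T ^ 2) := by positivity
      show |D (N + 1)| ≤ B + 2 * (γ ^ 2 / T ^ 2) * B₂
      rw [hDK N, hsplit N]
      calc _ ≤ |(N : ℝ) * (γ ^ 2 / T ^ 2) * (∫ t in Set.Ioi (0 : ℝ), (Cf N t - 2 * rf N t ^ 2))| +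
            |2 * (γ ^ 2 / T ^ 2) * ((N : ℝ) * ∫ t in Set.Ioi (0 : ℝ), rf N t ^ 2)| := abs_add_le _ _
        _ ≤ B + 2 * (γ ^ 2 / T ^ 2) * B₂ := by
            rw [abs_mul (2 * (γ ^ 2 / T ^ 2)), abs_of_nonneg hg]
            exact add_le_add h1 (mul_le_mul_of_nonneg_left h2 hg)
  · -- (←): along the canonical steady-state family
    intro hR ω₂ lam β γ hω hl hβ hγ T hT
    classical
    let μ : (N : ℕ) → ℝ → ℝ → Measure (PhaseSpace N) := fun N T_L T_R =>
      if h : 0 < T_L ∧ 0 < T_R then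
        Classical.choose (pinnedChain_exists_isSteadyState hω hl hβ hγ N h.1 h.2) else 0
    have hμ : ∀ (N : ℕ) (T_L T_R : ℝ), 0 < T_L → 0 < T_R →
        (pinnedChain ω₂ lam β γ).IsSteadyState N T_L T_R (μ N T_L T_R) := by
      intro N T_L T_R hL hR
      simp only [μ, dif_pos (And.intro hL hR)]
      exact Classical.choose_spec (pinnedChain_exists_isSteadyState hω hl hβ hγ N hL hR)
    have hKT := hK ω₂ lam β γ hω hl hβ hγ (hU ω₂ lam β γ hω hl hβ hγ) μ hμ T hT
    have hAT := hA ω₂ lam β γ hω hl hβ hγ T hT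
    set Cf : ℕ → ℝ → ℝ := fun N t => ((∫ z, (z.2 0) ^ 2 * (∫ y, (y.2 (Fin.last N)) ^ 2 ∂((pinnedChain ω₂ lam β γ).transitionKernel (N + 1) T T t.toNNReal z)) ∂((pinnedChain ω₂ lam β γ).gibbsMeasure (N + 1) T)) - (∫ z, (z.2 0) ^ 2 ∂((pinnedChain ω₂ lam β γ).gibbsMeasure (N + 1) T)) * (∫ z, (∫ y, (y.2 (Fin.last N)) ^ 2 ∂((pinnedChain ω₂ lam β γ).transitionKernel (N + 1) T T t.toNNReal z)) ∂((pinnedChain ω₂ lam β γ).gibbsMeasure (N + 1) T))) with hCf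
    set rf : ℕ → ℝ → ℝ := fun N t => (∫ z, z.2 0 * (∫ y, y.2 (Fin.last N) ∂((pinnedChain ω₂ lam β γ).transitionKernel (N + 1) T T t.toNNReal z)) ∂((pinnedChain ω₂ lam β γ).gibbsMeasure (N + 1) T)) with hrf
    -- the response coefficients along `μ`
    let D : ℕ → ℝ := fun M => ((M - 1 : ℕ) : ℝ) * (γ ^ 2 / T ^ 2) * ∫ t in Set.Ioi (0:ℝ), Cf (M - 1) t
    have hD : ∀ M : ℕ, Tendsto (fun δ : ℝ => (pinnedChain ω₂ lam β γ).totalCurrent (μ M (T + δ / 2) (T - δ / 2)) / δ)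
        (𝓝[≠] 0) (𝓝 (D M)) := by
      intro M
      cases M with
      | zero =>
        have h0 : D 0 = 0 := by simp [D]
        rw [h0]
        simp only [OscillatorChain.totalCurrent_zero, zero_div]
        exact tendsto_const_nhds
      | succ N =>
        have hN : D (N + 1) = (N : ℝ) * (γ ^ 2 / T ^ 2) * ∫ t in Set.Ioi (0:ℝ), Cf N t := by
          simp [D]
        rw [hN]
        exact (hKT N).2
    obtain ⟨B₁, hB₁⟩ := hR ω₂ lam β γ hω hl hβ hγ μ hμ T hT D hD
    obtain ⟨B₂, hB₂⟩ := exists_forall_abs_le_of_tendsto hAT.2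
    have hB₁' : ∀ N : ℕ, |(N : ℝ) * (γ ^ 2 / T ^ 2) * ∫ t in Set.Ioi (0:ℝ), Cf N t| ≤ B₁ := by
      intro N
      have h := hB₁ ⟨N + 1, rfl⟩
      simpa [D] using h
    refine ⟨B₁ + 2 * (γ ^ 2 / T ^ 2) * B₂, fun N => ?_⟩
    have hg : 0 ≤ 2 * (γ ^ 2 / T ^ 2) := by positivity
    have hsplit : (N : ℝ) * (γ ^ 2 / T ^ 2) * (∫ t in Set.Ioi (0 : ℝ), (Cf N t - 2 * rf N t ^ 2)) =
        (N : ℝ) * (γ ^ 2 / T ^ 2) * (∫ t in Set.Ioi (0 : ℝ), Cf N t) -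
          2 * (γ ^ 2 / T ^ 2) * ((N : ℝ) * ∫ t in Set.Ioi (0 : ℝ), rf N t ^ 2) := by
      rw [integral_split (hKT N).1 (hAT.1 N)]
      ring
    show |(N : ℝ) * (γ ^ 2 / T ^ 2) * (∫ t in Set.Ioi (0 : ℝ), (Cf N t - 2 * rf N t ^ 2))| ≤ _
    rw [hsplit]
    calc _ ≤ |(N : ℝ) * (γ ^ 2 / T ^ 2) * (∫ t in Set.Ioi (0 : ℝ), Cf N t)| +
          |2 * (γ ^ 2 / T ^ 2) * ((N : ℝ) * ∫ t in Set.Ioi (0 : ℝ), rf N t ^ 2)| := abs_sub _ _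
      _ ≤ B₁ + 2 * (γ ^ 2 / T ^ 2) * B₂ := by
          rw [abs_mul (2 * (γ ^ 2 / T ^ 2)), abs_of_nonneg hg]
          exact add_le_add (hB₁' N) (mul_le_mul_of_nonneg_left (hB₂ N) hg)

/-- `BoundedResponse` is, verbatim, the catalogued waypoint `HasBoundedResponse (pinnedChain ω₂ lam β γ)`
at every admissible parameter point (`hasBoundedResponse_iff` is `Iff.rfl`). [folklore] -/
theorem boundedResponse_iff_hasBoundedResponse :
    BoundedResponse ↔ ∀ ω₂ lam β γ : ℝ, 0 < ω₂ → 0 < lam → 0 < β → 0 < γ →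
      HasBoundedResponse (pinnedChain ω₂ lam β γ) :=
  Iff.rfl

/-- **Under `NessUnique`, `BoundaryKubo`, `CoherentDephasing` the item IS the catalogued bounded-response
waypoint**: `IncoherentBounded ↔ ∀ parameters > 0, HasBoundedResponse (pinnedChain ω₂ lam β γ)`
(barrier file `Literature.Barriers.AtomisticToContinuum.FixedLengthNoConductivityControl`: no `N`-uniform
bound on the finite-size conductivity of a deterministic anharmonic chain is in print).
[cite: BonettoLebowitzReyBellet2000, §6.3 (arXiv p. 12)] -/
theorem incoherentBounded_iff_hasBoundedResponse (hU : NessUnique) (hK : BoundaryKubo)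
    (hA : CoherentDephasing) :
    IncoherentBounded ↔ ∀ ω₂ lam β γ : ℝ, 0 < ω₂ → 0 < lam → 0 < β → 0 < γ →
      HasBoundedResponse (pinnedChain ω₂ lam β γ) :=
  (incoherentBounded_iff_boundedResponse hU hK hA).trans boundedResponse_iff_hasBoundedResponse

/-! ## 3. Fourier's law implies the item (under the sibling items) -/

/-- Under `NessUnique`, `BoundaryKubo`, `CoherentDephasing`, the sub-problem conjunct `FouriersLaw`
implies `IncoherentBounded` (it implies the crux `IncoherentChannel`, `incoherentChannel_iff_fouriersLaw`).
[cite: BonettoLebowitzReyBellet2000, §5.3 eq. (33)] -/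
theorem incoherentBounded_of_fouriersLaw (hU : NessUnique) (hK : BoundaryKubo)
    (hA : CoherentDephasing) (hF : _root_.FouriersLaw) : IncoherentBounded :=
  incoherentBounded_of_incoherentChannel
    ((IncoherentChannel.Negative.LoadBearing.incoherentChannel_iff_fouriersLaw hU hK hA).2 hF)


/-! ## 4. Unit-temperature normal form -/

section Scaling

variable {ω₂ lam β γ : ℝ} (hω : 0 < ω₂) (hl : 0 ≤ lam) (hβ : 0 ≤ β) (hγ : 0 ≤ γ)
include hω hl hβ hγ

/-- Boundedness of the item's sequence is invariant under the amplitude scaling: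
bounded at `(lam, β, s²T)` iff bounded at `(lam s², β s², T)` (the sequences coincide termwise,
`seqA_smul`). [folklore] -/
theorem bounded_at_smul_iff {s : ℝ} (hs : 0 < s) (T : ℝ) :
    (∃ B : ℝ, ∀ N : ℕ, |((N : ℝ) * (γ ^ 2 / (s ^ 2 * T) ^ 2) * ∫ t in Set.Ioi (0 : ℝ), (((∫ z, (z.2 0) ^ 2 * (∫ y, (y.2 (Fin.last N)) ^ 2 ∂((pinnedChain ω₂ lam β γ).transitionKernel (N + 1) (s ^ 2 * T) (s ^ 2 * T) (Real.toNNReal t) z)) ∂((pinnedChain ω₂ lam β γ).gibbsMeasure (N + 1) (s ^ 2 * T))) - (∫ z, (z.2 0) ^ 2 ∂((pinnedChain ω₂ lam β γ).gibbsMeasure (N + 1) (s ^ 2 * T))) * (∫ z, (∫ y, (y.2 (Fin.last N)) ^ 2 ∂((pinnedChain ω₂ lam β γ).transitionKernel (N + 1) (s ^ 2 * T) (s ^ 2 * T) (Real.toNNReal t) z)) ∂((pinnedChain ω₂ lam β γ).gibbsMeasure (N + 1) (s ^ 2 * T)))) - 2 * (∫ z, z.2 0 * (∫ y, y.2 (Fin.last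 N) ∂((pinnedChain ω₂ lam β γ).transitionKernel (N + 1) (s ^ 2 * T) (s ^ 2 * T) (Real.toNNReal t) z)) ∂((pinnedChain ω₂ lam β γ).gibbsMeasure (N + 1) (s ^ 2 * T))) ^ 2))| ≤ B) ↔
    (∃ B : ℝ, ∀ N : ℕ, |((N : ℝ) * (γ ^ 2 / T ^ 2) * ∫ t in Set.Ioi (0 : ℝ), (((∫ z, (z.2 0) ^ 2 * (∫ y, (y.2 (Fin.last N)) ^ 2 ∂((pinnedChain ω₂ (lam * s ^ 2) (β * s ^ 2) γ).transitionKernel (N + 1) T T (Real.toNNReal t) z)) ∂((pinnedChain ω₂ (lam * s ^ 2) (β * s ^ 2) γ).gibbsMeasure (N + 1) T)) - (∫ z, (z.2 0) ^ 2 ∂((pinnedChain ω₂ (lam * s ^ 2) (β * s ^ 2) γ).gibbsMeasure (N + 1) T)) * (∫ z, (∫ y, (y.2 (Fin.last N)) ^ 2 ∂((pinnedChain ω₂ (lam * s ^ 2) (β * s ^ 2) γ).transitionKernel (N + 1) T T (Real.toNNReal t) z)) ∂((pinnedChain ω₂ (lam * s ^ 2) (β * s ^ 2) γ).gibbsMeasure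 (N + 1) T))) - 2 * (∫ z, z.2 0 * (∫ y, y.2 (Fin.last N) ∂((pinnedChain ω₂ (lam * s ^ 2) (β * s ^ 2) γ).transitionKernel (N + 1) T T (Real.toNNReal t) z)) ∂((pinnedChain ω₂ (lam * s ^ 2) (β * s ^ 2) γ).gibbsMeasure (N + 1) T)) ^ 2))| ≤ B) := by
  have h : ∀ N : ℕ, ((N : ℝ) * (γ ^ 2 / (s ^ 2 * T) ^ 2) * ∫ t in Set.Ioi (0 : ℝ), (((∫ z, (z.2 0) ^ 2 * (∫ y, (y.2 (Fin.last N)) ^ 2 ∂((pinnedChain ω₂ lam β γ).transitionKernel (N + 1) (s ^ 2 * T) (s ^ 2 * T) (Real.toNNReal t) z)) ∂((pinnedChain ω₂ lam β γ).gibbsMeasure (N + 1) (s ^ 2 * T))) - (∫ z, (z.2 0) ^ 2 ∂((pinnedChain ω₂ lam β γ).gibbsMeasure (N + 1) (s ^ 2 * T))) * (∫ z, (∫ y, (y.2 (Fin.last N)) ^ 2 ∂((pinnedChain ω₂ lam β γ).transitionKernel (N + 1) (s ^ 2 * T) (s ^ 2 * T) (Real.toNNReal t) z)) ∂((pinnedChain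 ω₂ lam β γ).gibbsMeasure (N + 1) (s ^ 2 * T)))) - 2 * (∫ z, z.2 0 * (∫ y, y.2 (Fin.last N) ∂((pinnedChain ω₂ lam β γ).transitionKernel (N + 1) (s ^ 2 * T) (s ^ 2 * T) (Real.toNNReal t) z)) ∂((pinnedChain ω₂ lam β γ).gibbsMeasure (N + 1) (s ^ 2 * T))) ^ 2)) =
      ((N : ℝ) * (γ ^ 2 / T ^ 2) * ∫ t in Set.Ioi (0 : ℝ), (((∫ z, (z.2 0) ^ 2 * (∫ y, (y.2 (Fin.last N)) ^ 2 ∂((pinnedChain ω₂ (lam * s ^ 2) (β * s ^ 2) γ).transitionKernel (N + 1) T T (Real.toNNReal t) z)) ∂((pinnedChain ω₂ (lam * s ^ 2) (β * s ^ 2) γ).gibbsMeasure (N + 1) T)) - (∫ z, (z.2 0) ^ 2 ∂((pinnedChain ω₂ (lam * s ^ 2) (β * s ^ 2) γ).gibbsMeasure (N + 1) T)) * (∫ z, (∫ y, (y.2 (Fin.last N)) ^ 2 ∂((pinnedChain ω₂ (lam * s ^ 2) (β * s ^ 2) γ).transitionKernel (N + 1) T T (Real.toNNReal t) z)) ∂((pinnedChain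 ω₂ (lam * s ^ 2) (β * s ^ 2) γ).gibbsMeasure (N + 1) T))) - 2 * (∫ z, z.2 0 * (∫ y, y.2 (Fin.last N) ∂((pinnedChain ω₂ (lam * s ^ 2) (β * s ^ 2) γ).transitionKernel (N + 1) T T (Real.toNNReal t) z)) ∂((pinnedChain ω₂ (lam * s ^ 2) (β * s ^ 2) γ).gibbsMeasure (N + 1) T)) ^ 2)) :=
    fun N => IncoherentChannel.Negative.UnitTemperature.seqA_smul hω hl hβ hγ hs T N
  simp only [h]

end Scaling

/-- **UNIT-TEMPERATURE NORMAL FORM OF THE ITEM.** `IncoherentBounded` is equivalent to its `T = 1` slice over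
all positive `(ω₂, lam, β, γ)`: by the amplitude-scaling conjugacy temperature enters only through the
effective couplings `lam·T`, `β·T` (so `T → 0` at fixed `lam, β` is the harmonic corner, where `a_N ≡ 0`).
[cite: AokiLukkarinenSpohn2006, §2 eqs. (2.8)-(2.13)] -/
theorem incoherentBounded_iff_unit_temperature :
    IncoherentBounded ↔ ∀ ω₂ lam β γ : ℝ, 0 < ω₂ → 0 < lam → 0 < β → 0 < γ →
      ∃ B : ℝ, ∀ N : ℕ, |((N : ℝ) * (γ ^ 2 / 1 ^ 2) * ∫ t in Set.Ioi (0 : ℝ), (((∫ z, (z.2 0) ^ 2 * (∫ y, (y.2 (Fin.last N)) ^ 2 ∂((pinnedChain ω₂ lam β γ).transitionKernel (N + 1) 1 1 (Real.toNNReal t) z)) ∂((pinnedChain ω₂ lam β γ).gibbsMeasure (N + 1) 1)) - (∫ z, (z.2 0) ^ 2 ∂((pinnedChain ω₂ lam β γ).gibbsMeasure (N + 1) 1)) * (∫ z, (∫ y, (y.2 (Fin.last N)) ^ 2 ∂((pinnedChain ω₂ lam β γ).transitionKernel (N + 1) 1 1 (Real.toNNReal t) z)) ∂((pinnedChain ω₂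 lam β γ).gibbsMeasure (N + 1) 1))) - 2 * (∫ z, z.2 0 * (∫ y, y.2 (Fin.last N) ∂((pinnedChain ω₂ lam β γ).transitionKernel (N + 1) 1 1 (Real.toNNReal t) z)) ∂((pinnedChain ω₂ lam β γ).gibbsMeasure (N + 1) 1)) ^ 2))| ≤ B := by
  constructor
  · intro h ω₂ lam β γ hω hl hβ hγ
    exact h ω₂ lam β γ hω hl hβ hγ 1 one_pos
  · intro h ω₂ lam β γ hω hl hβ hγ T hT
    have hs : 0 < Real.sqrt T := Real.sqrt_pos.2 hT
    have hT' : Real.sqrt T ^ 2 = T := Real.sq_sqrt hT.le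
    have hiff := bounded_at_smul_iff (ω₂ := ω₂) (lam := lam) (β := β) (γ := γ) hω hl.le hβ.le hγ.le hs 1
    rw [mul_one, hT'] at hiff
    rw [hiff]
    exact h ω₂ (lam * T) (β * T) γ hω (by positivity) (by positivity) hγ

end Summit.AtomisticToContinuum.FouriersLaw.Theorems.IncoherentBounded

end
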